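import Literature.MathematicalPhysics.QuantumFieldTheory.Balaban1983to89.B9Ineq349MultiLevelBox
import Literature.MathematicalPhysics.QuantumFieldTheory.Balaban1983to89.B6Prop23MultiLevelBox

/-!
# `Balaban1983to89.B9Ineq349MultiLevelBoxP23` — T. Bałaban, *Propagators for lattice gauge theories in a background field*, Commun.
# Math. Phys. **99** (1985) 389–434 [Balaban1985BackgroundPropagators], **(3.49)** p. 399 for `P = I − R = G′Q′\*(Q′G′²Q′\*)⁻¹Q′G′`
# **AT U = 1 ON THE GENUINE `k`-LEVEL NEUMANN-BOX FAMILY, ALL FOUR ENTRIES, GENUINE LEVEL PREFACTORS — HYPOTHESIS-FREE**: the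
# argument `G` of `B9Ineq349MultiLevelBox` instantiated with THE inverse `(Q′G′²Q′\*)⁻¹` of [B6] Proposition 2.3 for this family
# (`B6Prop23MultiLevelBox.prop23_multiLevelBox`, seat p21, p334402 ACCEPTED commit e15891335114, 2026-08-22T16:57Z)

statement-level skeleton of published theorems with citation tags; proofs where landed; nothing here is a claim about the Yang–Mills mass gap

CITATION HEADER (lean-in-tree rule).  Cell `lit-balaban`, unit `lit-balaban-r05` gen 44 (B8 reader/typer; courtesy instance in the B9
block — owner r06, rows B9.Eq3.49 / B9.Eq3.25 heads r06's call; the announced successor step of `B9Ineq349MultiLevelBox` p334945 ACCEPTED commit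
6ae110b5ba8e, HOME/lit-balaban-r05/HANDOFF.md § gen 44).  WHAT IS REPRODUCED = the display (3.49) at U = 1 on the multi-level flat carriers,
NOW WITH NO HYPOTHESIS: `B9Ineq349MultiLevelBox.ineq349_multiLevelBox_of_inverse` proved the four kernel bounds of
`P = G′Q′\*GQ′G′` for EVERY operator `G` on `𝔅` carrying the printed (2.87)-bound of `(Q′G′²Q′\*)⁻¹`;
`B6Prop23MultiLevelBox.prop23_multiLevelBox` (p21) supplies, for every member of the family, THE operator `G` with
`G·(Q′G′²Q′\*) = 1`, `(Q′G′²Q′\*)·G = 1` and (2.87).  This file is the three-line composition: for every nested family `D` and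
windowed weights there IS an operator `G` — the two-sided inverse of `Q′G′²Q′\*`, hence `(Q′G′²Q′\*)⁻¹` itself — such that
`P = G′Q′\*GQ′G′` is a projection complementary to `R` and obeys (3.49) with constants depending on `d, ℓ` and the weight windows
only.  Kind «kernel-checked proof of a model instance»; theorems only; every input BY NAME; 0 sorry.

WHAT IS PRINTED (verbatim).  p. 399 [PDF 11]: *"For the operator P = I − R we obtain, using again Lemma 2.1, [|P(x, x′)|,
|(DP)_μ(x, x′)|, |(PD\*)_ν(x, x′)|, |(DPD\*)_{μν}(x, x′)|] ≦ O(1)[1, (Lʲη)⁻¹, (Lʲη)⁻¹, (Lʲη)⁻²](L^{j′}η)^{−d}e^{−½δ₀d(y,y′)} for x ∈ Δ(y),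
y ∈ Λ_j, x′ ∈ Δ(y′), y′ ∈ Λ_{j′}. (3.49)"*, *"This way the theorems are reduced to the corresponding theorems for propagators without
external gauge field. They were proved in [4]."*; p. 394 [PDF 6] (3.25); [B6] Prop. 2.3 (2.87) p. 238; p. 235 «Of course the
operator Q′G′²Q′\* is positive definite, so its inverse is well defined».

HONEST SCOPE / NOT CLAIMED.  As `B9Ineq349MultiLevelBox`: U = 1 only, Neumann box, levels `1 … k` with `Ω₁ = X`, scalar fibre,
lattice units, `x ∈ Δ(y), y ∈ Λ_j` read at the point's own block and level, `D\*` = transpose of the forward unit difference,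
no Hölder clause; constants existential (functions of `d, ℓ` and the windows; print: O(1), ½δ₀ depending on d, L); thresholds
«M, RM sufficiently large» explicit.  The general (3.49) at a background `U` with (3.35) ([4] Thms 3.1–3.2) is r06's theorem on
printed-shape letters; rows B9.Eq3.49 / B9.Eq3.25 heads NOT changed.  NOT summit progress, NOT continuum, NOT Clay.
-/

namespace Literature.MathematicalPhysics.QuantumFieldTheory.Balaban1983to89.B9Ineq349MultiLevelBoxP23

open Matrix
open B4Reflection242 (boxDom)
open B6MultiLevelBoxOperator
open B6Geom246MultiLevelBox
open B6Ineq268MultiLevelBox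
open B6Prop22DerivMultiLevelBox (dMat)
open B6Ineq243TwoLevelBox (aNext)
open B6Expansion282 (kerOp)
open B6Prop23MultiLevelBox (prop23_multiLevelBox)
open B8Ineq192MultiLevelBox (rProjML)
open B9Ineq349MultiLevelBox

noncomputable section

variable {d : ℕ}

/-- **(3.49) AT U = 1 ON THE `k`-LEVEL NEUMANN-BOX FAMILY — ALL FOUR ENTRIES, GENUINE LEVEL PREFACTORS, HYPOTHESIS-FREE**: there are
`ρ, B, M₀ > 0`, `N₀ ≥ 1` (functions of `d, ℓ` and the weight windows) such that for every `k`, `M_h ≥ 3` with `L·M_h ≥ M₀`, `R ≥ 2L`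
with `R·L·M_h ≥ N₀ + 1`, every box, every nested family `D` with (2.1)–(2.2) and every windowed weight sequence there is an operator
`G` on `𝔅` which is THE two-sided inverse of `Q′G′²Q′*` (`G·(Q′G′²Q′*) = 1 = (Q′G′²Q′*)·G`), for which `P = G′Q′*GQ′G′` (`pProjML`) is a
projection (`P² = P`) with `P·R = 0` (`R = 1 − P`, (3.25)), and for all fine points `x, x′` (levels `j = D.lev x`, `j′ = D.lev x′`,
`W(y(x′)) = (L^{j′})^{d+1}`) and axes `μ, ν`: `|P(x,x′)| ≦ B(L^{j′})^{−(d+1)}e^{−ρd(y(x),y(x′))}`,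
`|(D_μP)(x,x′)|, |(PD*_ν)(x,x′)| ≦ B(Lʲ)⁻¹(L^{j′})^{−(d+1)}e^{−ρd}`, `|(D_μPD*_ν)(x,x′)| ≦ B(Lʲ)⁻²(L^{j′})^{−(d+1)}e^{−ρd}`.
[cite: Balaban1985BackgroundPropagators, (3.49) p.399, (3.25) p.394; Balaban1984PropagatorsII, Prop. 2.3 (2.86)–(2.87) p.238, p.235] -/
theorem ineq349_multiLevelBox (d ℓ : ℕ) (hℓ : 1 ≤ ℓ) (aminus aplus a2minus a2plus : ℝ) (ha : 0 < aminus)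
    (ha2 : 0 < a2minus) :
    ∃ ρ B M₀ : ℝ, ∃ N₀ : ℕ, 0 < ρ ∧ 0 < B ∧ 0 < M₀ ∧ 0 < N₀ ∧
      ∀ (k Mh R : ℕ), 3 ≤ Mh → M₀ ≤ ((ℓ : ℝ) + 1) * Mh → 2 * (ℓ + 1) ≤ R → N₀ + 1 ≤ R * ((ℓ + 1) * Mh) →
      ∀ (P : Fin (d + 1) → ℕ) (_hP : ∀ μ, 1 ≤ P μ) (D : Domains d ℓ Mh k P R) (a c : ℕ → ℝ),
        (∀ i, 1 ≤ i → aminus ≤ a i ∧ a i ≤ aplus) → (∀ i, 1 ≤ i → a2minus ≤ c i ∧ c i ≤ a2plus) →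
        (∀ i, 1 ≤ i → a (i + 1) = aNext ℓ (a i) (c i)) →
        ∃ G : Module.End ℝ (↥(bset D) → ℝ),
          G * kerOp (W D) (Xk D a) = 1 ∧ kerOp (W D) (Xk D a) * G = 1 ∧
          (∀ f, pProjML D a G (pProjML D a G f) = pProjML D a G f) ∧
          (∀ f, pProjML D a G (rProjML D a G f) = 0) ∧
          ∀ (x x' : ↥(boxDom (N0 ℓ Mh k P))),
            |pProjML D a G (Pi.single x' 1) x| ≤
              B * (W D (blkOf D x'))⁻¹ * Real.exp (-(ρ * (geom D).dist (blkOf D x) (blkOf D x'))) ∧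
            (∀ μ : Fin (d + 1), |(dMat (N0 ℓ Mh k P) μ *ᵥ pProjML D a G (Pi.single x' 1)) x| ≤
              B * (((ℓ : ℝ) + 1) ^ D.lev x.1)⁻¹ * (W D (blkOf D x'))⁻¹ *
                Real.exp (-(ρ * (geom D).dist (blkOf D x) (blkOf D x')))) ∧
            (∀ ν : Fin (d + 1), |pProjML D a G ((dMat (N0 ℓ Mh k P) ν)ᵀ *ᵥ Pi.single x' 1) x| ≤
              B * (((ℓ : ℝ) + 1) ^ D.lev x.1)⁻¹ * (W D (blkOf D x'))⁻¹ *
                Real.exp (-(ρ * (geom D).dist (blkOf D x) (blkOf D x')))) ∧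
            (∀ μ ν : Fin (d + 1),
              |(dMat (N0 ℓ Mh k P) μ *ᵥ pProjML D a G ((dMat (N0 ℓ Mh k P) ν)ᵀ *ᵥ Pi.single x' 1)) x| ≤
              B * ((((ℓ : ℝ) + 1) ^ D.lev x.1) ^ 2)⁻¹ * (W D (blkOf D x'))⁻¹ *
                Real.exp (-(ρ * (geom D).dist (blkOf D x) (blkOf D x')))) := by
  obtain ⟨δ₁, C₁, M₁, hδ₁, hC₁, hM₁, hP5⟩ := prop23_multiLevelBox d ℓ hℓ aminus aplus a2minus a2plus ha ha2
  obtain ⟨ρ, B, M₀, N₀, hρ, hB, hM₀, hN₀, h⟩ :=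
    ineq349_multiLevelBox_of_inverse d ℓ hℓ aminus aplus a2minus a2plus ha ha2 hC₁ hδ₁
  refine ⟨ρ, B, max M₀ M₁, N₀, hρ, hB, lt_max_of_lt_left hM₀, hN₀, ?_⟩
  intro k Mh R hMh hM hR hRM P hP D a c haw hcw hac
  obtain ⟨G, h1, h2, -, -, h5, -⟩ := hP5 k Mh R ((le_max_right _ _).trans hM) hR P hP D a c haw hcw hac
  exact ⟨G, h1, h2, fun f => pProjML_idem h2 f, fun f => pProjML_rProjML h2 f,
    h k Mh R hMh ((le_max_left _ _).trans hM) hR hRM P hP D a c haw hcw hac G h5⟩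

/-- **the same for the off-identity part `R − 1 = −P` of THE projection `R` of (3.25)** — the form in which (3.49) serves «the
operator R, or DRD\*» (p. 399). [cite: Balaban1985BackgroundPropagators, (3.49) p.399, (3.25) p.394; Balaban1984PropagatorsII, Prop. 2.3 (2.87) p.238] -/
theorem ineq349_multiLevelBox_R (d ℓ : ℕ) (hℓ : 1 ≤ ℓ) (aminus aplus a2minus a2plus : ℝ) (ha : 0 < aminus)
    (ha2 : 0 < a2minus) :
    ∃ ρ B M₀ : ℝ, ∃ N₀ : ℕ, 0 < ρ ∧ 0 < B ∧ 0 < M₀ ∧ 0 < N₀ ∧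
      ∀ (k Mh R : ℕ), 3 ≤ Mh → M₀ ≤ ((ℓ : ℝ) + 1) * Mh → 2 * (ℓ + 1) ≤ R → N₀ + 1 ≤ R * ((ℓ + 1) * Mh) →
      ∀ (P : Fin (d + 1) → ℕ) (_hP : ∀ μ, 1 ≤ P μ) (D : Domains d ℓ Mh k P R) (a c : ℕ → ℝ),
        (∀ i, 1 ≤ i → aminus ≤ a i ∧ a i ≤ aplus) → (∀ i, 1 ≤ i → a2minus ≤ c i ∧ c i ≤ a2plus) →
        (∀ i, 1 ≤ i → a (i + 1) = aNext ℓ (a i) (c i)) →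
        ∃ G : Module.End ℝ (↥(bset D) → ℝ),
          G * kerOp (W D) (Xk D a) = 1 ∧ kerOp (W D) (Xk D a) * G = 1 ∧
          ∀ (x x' : ↥(boxDom (N0 ℓ Mh k P))),
            |(rProjML D a G - 1) (Pi.single x' 1) x| ≤
              B * (W D (blkOf D x'))⁻¹ * Real.exp (-(ρ * (geom D).dist (blkOf D x) (blkOf D x'))) ∧
            (∀ μ : Fin (d + 1), |(dMat (N0 ℓ Mh k P) μ *ᵥ (rProjML D a G - 1) (Pi.single x' 1)) x| ≤
              B * (((ℓ : ℝ) + 1) ^ D.lev x.1)⁻¹ * (W D (blkOf D x'))⁻¹ *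
                Real.exp (-(ρ * (geom D).dist (blkOf D x) (blkOf D x')))) ∧
            (∀ ν : Fin (d + 1), |(rProjML D a G - 1) ((dMat (N0 ℓ Mh k P) ν)ᵀ *ᵥ Pi.single x' 1) x| ≤
              B * (((ℓ : ℝ) + 1) ^ D.lev x.1)⁻¹ * (W D (blkOf D x'))⁻¹ *
                Real.exp (-(ρ * (geom D).dist (blkOf D x) (blkOf D x')))) ∧
            (∀ μ ν : Fin (d + 1),
              |(dMat (N0 ℓ Mh k P) μ *ᵥ (rProjML D a G - 1) ((dMat (N0 ℓ Mh k P) ν)ᵀ *ᵥ Pi.single x' 1)) x| ≤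
              B * ((((ℓ : ℝ) + 1) ^ D.lev x.1) ^ 2)⁻¹ * (W D (blkOf D x'))⁻¹ *
                Real.exp (-(ρ * (geom D).dist (blkOf D x) (blkOf D x')))) := by
  obtain ⟨δ₁, C₁, M₁, hδ₁, hC₁, hM₁, hP5⟩ := prop23_multiLevelBox d ℓ hℓ aminus aplus a2minus a2plus ha ha2
  obtain ⟨ρ, B, M₀, N₀, hρ, hB, hM₀, hN₀, h⟩ :=
    ineq349_multiLevelBox_R_of_inverse d ℓ hℓ aminus aplus a2minus a2plus ha ha2 hC₁ hδ₁
  refine ⟨ρ, B, max M₀ M₁, N₀, hρ, hB, lt_max_of_lt_left hM₀, hN₀, ?_⟩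
  intro k Mh R hMh hM hR hRM P hP D a c haw hcw hac
  obtain ⟨G, h1, h2, -, -, h5, -⟩ := hP5 k Mh R ((le_max_right _ _).trans hM) hR P hP D a c haw hcw hac
  exact ⟨G, h1, h2, h k Mh R hMh ((le_max_left _ _).trans hM) hR hRM P hP D a c haw hcw hac G h5⟩

end

end Literature.MathematicalPhysics.QuantumFieldTheory.Balaban1983to89.B9Ineq349MultiLevelBoxP23
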